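import Literature.AlgebraicGeometry.HodgeTheory.FermatHodgeCharacterCriterion
import HarnessLib

/-!
# Hodge characters of large-prime level: level decomposition and the bookkeeping lemma

Crux `HodgeFermatVarieties` (stmt-HodgeConjecture-1334), line `cancel-by-any-claim-lattice`, stub S6 of
the gen-6 skeleton (lead c2), arithmetic half, part 1 of 2 (part 2: `…PairedOfLargePrimes`, which
proves `isPaired_of_primeFactors_gt`). Elementary tools:

* the EXACT LEVEL `M = m / gcd(m, ⟨x⟩)` of a residue `x` mod `m` and its UNIT PART
  `w = ⟨x⟩ / (m/M)` mod `M` (`unitPart_spec`: `w` is a unit and `x = (m/M)·⟨w⟩`; behaviour under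
  `x ↦ -x`; injectivity of `x ↦ (M, w)`), the coordinates in which Aoki's criterion
  (`IsHodge.aoki_criterion`) is written;
* fibrewise summation against multiplicities (`sum_comp_eq_sum_card_mul`), the vanishing of an odd
  function summed against even multiplicities (`sum_eq_zero_of_even_of_odd`), `(χ x)⁻¹ = conj (χ x)`;
* `sum_level_eq_zero_of_criterion` — the abstract bookkeeping step: in the criterion at level `f = M`
  (odd `χ`), the entries of the levels `L ⊋ M` drop out as soon as their multiplicities are even, and
  what remains is `∑_{level = M} χ(unit part)⁻¹ = 0`.

Everything here is proved; no named facts.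

References: [Aoki1983] N. Aoki, Math. Ann. 266 (1983) 23–54, Prop. 2.1–2.2 and §9 (I).
-/

set_option linter.dupNamespace false

noncomputable section

open Finset
open Literature.AlgebraicGeometry.HodgeTheory Literature.AlgebraicGeometry.HodgeTheory.FermatCharacter

namespace Summit.HodgeConjecture.HodgeConjecture.Theorems.CancelByAnyClaimLattice

namespace PairedNull

section LevelData

variable {m : ℕ} [NeZero m]

/-! ### The exact level `m / gcd(m, ⟨x⟩)` and the unit part `⟨x⟩ / (m/M)` of a residue -/

omit [NeZero m] in
/-- The exact level of `x` divides `m`. [folklore] -/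
theorem level_dvd (x : ZMod m) : m / m.gcd x.val ∣ m :=
  Nat.div_dvd_of_dvd (Nat.gcd_dvd_left m x.val)

/-- The exact level is positive. [folklore] -/
theorem level_pos (x : ZMod m) : 0 < m / m.gcd x.val :=
  Nat.div_pos (Nat.le_of_dvd (NeZero.pos m) (Nat.gcd_dvd_left m x.val)) (Nat.gcd_pos_of_pos_left _ (NeZero.pos m))

/-- **Level decomposition**: with `M = m / gcd(m, ⟨x⟩)` the exact level of `x`, the unit part
`w = ⟨x⟩ / (m/M)` (read mod `M`) is a unit mod `M` and `x = (m/M) · ⟨w⟩`.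
[cite: Aoki1983, Prop. 2.1 (the points of exact level M)] -/
theorem unitPart_spec (x : ZMod m) :
    IsUnit (((x.val / (m / (m / m.gcd x.val)) : ℕ) : ZMod (m / m.gcd x.val))) ∧
      ((m / (m / m.gcd x.val) : ℕ) : ZMod m) *
        ((ZMod.val (((x.val / (m / (m / m.gcd x.val)) : ℕ) : ZMod (m / m.gcd x.val))) : ℕ) : ZMod m) = x := by
  set M := m / m.gcd x.val with hM
  haveI : NeZero M := ⟨(level_pos x).ne'⟩
  obtain ⟨hMm, w, hw, hwx⟩ := exists_unit_lift_eq x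
  have hMpos : 0 < m / M := Nat.div_pos (Nat.le_of_dvd (NeZero.pos m) hMm) (NeZero.pos M)
  -- `x.val = (m/M) * w.val`
  have hlt : m / M * w.val < m := by
    calc m / M * w.val < m / M * M := (Nat.mul_lt_mul_left hMpos).mpr (ZMod.val_lt w)
      _ = m := Nat.div_mul_cancel hMm
  have hv2 : ZMod.val (((m / M : ℕ) : ZMod m) * ((w.val : ℕ) : ZMod m)) = m / M * w.val := by
    rw [← Nat.cast_mul, ZMod.val_natCast, Nat.mod_eq_of_lt hlt]
  have hval : x.val = m / M * w.val := by
    have := congrArg ZMod.val hwx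
    rw [hv2] at this
    exact this.symm
  have hdiv : x.val / (m / M) = w.val :=
    (congrArg (· / (m / M)) hval).trans (Nat.mul_div_cancel_left _ hMpos)
  have hw' : (((x.val / (m / M)) : ℕ) : ZMod M) = w := by rw [hdiv, ZMod.natCast_zmod_val]
  rw [hw']
  exact ⟨hw, hwx⟩

/-- Two residues with the same exact level `M` and the same unit part mod `M` are equal. [folklore] -/
theorem eq_of_level_eq_of_unitPart_eq {x y : ZMod m} {M : ℕ} (hxM : m / m.gcd x.val = M)
    (hyM : m / m.gcd y.val = M)
    (hu : (((x.val / (m / M)) : ℕ) : ZMod M) = (((y.val / (m / M)) : ℕ) : ZMod M)) : x = y := by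
  subst hyM
  have hx := (unitPart_spec x).2
  have hy := (unitPart_spec y).2
  rw [hxM] at hx
  rw [hu] at hx
  exact hx.symm.trans hy

/-- The exact level of `-x` is that of `x`. [folklore] -/
theorem level_neg (x : ZMod m) : m / m.gcd (-x).val = m / m.gcd x.val := by
  by_cases hx : x = 0
  · rw [hx, neg_zero]
  · haveI : NeZero x := ⟨hx⟩
    rw [ZMod.val_neg_of_ne_zero x, Nat.gcd_self_sub_right (ZMod.val_le x)]

/-- The unit part of `-x` at the level `M` of `x` is minus that of `x`. [folklore] -/
theorem unitPart_neg {x : ZMod m} (hx : x ≠ 0) {M : ℕ} (hM : m / m.gcd x.val = M) :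
    ((((-x).val / (m / M)) : ℕ) : ZMod M) = -((((x.val / (m / M)) : ℕ) : ZMod M)) := by
  haveI : NeZero x := ⟨hx⟩
  have hMm : M ∣ m := hM ▸ level_dvd x
  have hMpos' : 0 < M := hM ▸ level_pos x
  haveI : NeZero M := ⟨hMpos'.ne'⟩
  obtain ⟨hw, hwx⟩ := unitPart_spec x
  rw [hM] at hwx hw
  set w : ZMod M := (((x.val / (m / M)) : ℕ) : ZMod M) with hwdef
  have hMpos : 0 < m / M := Nat.div_pos (Nat.le_of_dvd (NeZero.pos m) hMm) hMpos'
  have hlt : m / M * w.val < m := by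
    calc m / M * w.val < m / M * M := (Nat.mul_lt_mul_left hMpos).mpr (ZMod.val_lt w)
      _ = m := Nat.div_mul_cancel hMm
  have hv2 : ZMod.val (((m / M : ℕ) : ZMod m) * ((w.val : ℕ) : ZMod m)) = m / M * w.val := by
    rw [← Nat.cast_mul, ZMod.val_natCast, Nat.mod_eq_of_lt hlt]
  have hval : x.val = m / M * w.val := by
    have := congrArg ZMod.val hwx
    rw [hv2] at this
    exact this.symm
  have hnegval : (-x).val = m / M * (M - w.val) := by
    rw [ZMod.val_neg_of_ne_zero x, hval, Nat.mul_sub, Nat.div_mul_cancel hMm]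
  rw [hnegval, Nat.mul_div_cancel_left _ hMpos, Nat.cast_sub (ZMod.val_le w), ZMod.natCast_self,
    zero_sub, ZMod.natCast_zmod_val]

end LevelData

section Counting

variable {R : ℕ}

/-- **Summing a function of `ρ i` fibrewise**: `∑_{i ∈ I} f(ρ i) = ∑_u #{i ∈ I : ρ i = u} · f(u)`.
[folklore] -/
theorem sum_comp_eq_sum_card_mul {M : ℕ} [NeZero M] (I : Finset (Fin R)) (ρ : Fin R → ZMod M)
    (f : ZMod M → ℂ) : ∑ i ∈ I, f (ρ i) = ∑ u : ZMod M, (#(I.filter fun i ↦ ρ i = u) : ℂ) * f u := by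
  classical
  rw [← Finset.sum_fiberwise_of_maps_to (g := ρ) (t := univ) (fun i _ ↦ mem_univ (ρ i))]
  refine Finset.sum_congr rfl fun u _ ↦ ?_
  rw [Finset.sum_congr rfl (fun i hi ↦ by rw [(mem_filter.mp hi).2] : ∀ i ∈ I.filter (fun i ↦ ρ i = u),
    f (ρ i) = f u), Finset.sum_const, nsmul_eq_mul]

/-- **Odd sums against even multiplicities vanish**: if the multiplicities `#{i ∈ I : ρ i = u}` are
symmetric under `u ↦ -u` and `g(-u) = -g(u)`, then `∑_{i ∈ I} g(ρ i) = 0`. [folklore] -/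
theorem sum_eq_zero_of_even_of_odd {M : ℕ} [NeZero M] (I : Finset (Fin R)) (ρ : Fin R → ZMod M)
    (g : ZMod M → ℂ) (hg : ∀ u, g (-u) = -g u)
    (heven : ∀ u : ZMod M, #(I.filter fun i ↦ ρ i = -u) = #(I.filter fun i ↦ ρ i = u)) :
    ∑ i ∈ I, g (ρ i) = 0 := by
  classical
  have hneg : ∑ u : ZMod M, (#(I.filter fun i ↦ ρ i = u) : ℂ) * g u =
      ∑ u : ZMod M, (#(I.filter fun i ↦ ρ i = -u) : ℂ) * g (-u) :=
    (Equiv.sum_comp (Equiv.neg (ZMod M)) (fun u ↦ (#(I.filter fun i ↦ ρ i = u) : ℂ) * g u)).symm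
  have hS : ∑ u : ZMod M, (#(I.filter fun i ↦ ρ i = u) : ℂ) * g u =
      -∑ u : ZMod M, (#(I.filter fun i ↦ ρ i = u) : ℂ) * g u := by
    conv_lhs => rw [hneg]
    rw [← Finset.sum_neg_distrib]
    refine Finset.sum_congr rfl fun u _ ↦ ?_
    rw [heven u, hg u]; ring
  rw [sum_comp_eq_sum_card_mul]
  linear_combination hS / 2

/-- The values of a Dirichlet character satisfy `(χ x)⁻¹ = conj (χ x)`. [folklore] -/
theorem char_inv_eq_conj {M : ℕ} [NeZero M] (χ : DirichletCharacter ℂ M) (x : ZMod M) :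
    (χ x)⁻¹ = starRingEnd ℂ (χ x) := by
  by_cases hx : IsUnit x
  · exact Complex.inv_eq_conj (χ.unit_norm_eq_one hx.unit ▸ by rw [IsUnit.unit_spec])
  · rw [χ.map_nonunit hx, inv_zero, map_zero]

/-- **The bookkeeping step of the induction, in abstract form.** A relation
`∑ᵢ [M ∣ Lᵢ] A(Lᵢ) χ(wᵢ mod M)⁻¹ = 0` over entries `wᵢ` of levels `Lᵢ` (Aoki's criterion at `f = M`
for an odd `χ`), in which the entries of every level `L ⊋ M` have even multiplicities, reduces to
`∑_{Lᵢ = M} χ(wᵢ)⁻¹ = 0` (the levels `L ⊋ M` drop out because `χ` is odd, and `A(M) ≠ 0`).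
[cite: Aoki1983, Prop. 2.2 and §9 (I)] -/
theorem sum_level_eq_zero_of_criterion : ∀ {R M : ℕ} [NeZero M] (χ : DirichletCharacter ℂ M), χ.Odd → ∀ (lv : Fin R → ℕ), (∀ i, lv i ≠ 0) → ∀ (w : (i : Fin R) → ZMod (lv i)) (A : ℕ → ℂ), A M ≠ 0 → ∑ i, (if M ∣ lv i then A (lv i) * (χ (ZMod.cast (w i) : ZMod M))⁻¹ else 0) = 0 → ∀ (rdM : Fin R → ZMod M), (∀ i, lv i = M → (ZMod.cast (w i) : ZMod M) = rdM i) → ∀ (rd : (L : ℕ) → Fin R → ZMod L), (∀ (L : ℕ) (hML : M ∣ L) (i : Fin R), lv i = L → (ZMod.cast (w i) : ZMod M) = ZMod.castHom hML (ZMod M) (rd L i)) → (∀ L : ℕ, (∃ i, lv i = L) → M ∣ L → L ≠ M → ∀ u : ZMod L, #(univ.filter fun i ↦ lv i = L ∧ rd L i = -u) = #(univ.filter fun i ↦ lv i = L ∧ rd L i = u)) → ∑ i ∈ univ.filter (fun i ↦ lv i = M), (χ (rdM i))⁻¹ = 0 := by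
  intro R M _ χ hχ lv hlv w A hA key rdM hrdM rd hrd heven
  classical
  have hterm : ∀ i, (if M ∣ lv i then A (lv i) * (χ (ZMod.cast (w i) : ZMod M))⁻¹ else 0) =
      (if lv i = M then A M * (χ (rdM i))⁻¹ else 0) +
      (if M ∣ lv i ∧ lv i ≠ M then A (lv i) * (χ (ZMod.cast (w i) : ZMod M))⁻¹ else 0) := by
    intro i
    by_cases hli : lv i = M
    · rw [if_pos (by rw [hli]), if_pos hli, if_neg (fun hh ↦ hh.2 hli), add_zero, hrdM i hli, hli]
    · by_cases hdi : M ∣ lv i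
      · rw [if_pos hdi, if_neg hli, if_pos ⟨hdi, hli⟩, zero_add]
      · rw [if_neg hdi, if_neg hli, if_neg (fun hh ↦ hdi hh.1), add_zero]
  rw [Finset.sum_congr rfl fun i _ ↦ hterm i, Finset.sum_add_distrib] at key
  -- the proper multiples of `M` contribute zero
  have hzero : ∑ i, (if M ∣ lv i ∧ lv i ≠ M then A (lv i) * (χ (ZMod.cast (w i) : ZMod M))⁻¹ else 0) = 0 := by
    rw [← Finset.sum_filter]
    set I : Finset (Fin R) := univ.filter fun i ↦ M ∣ lv i ∧ lv i ≠ M with hI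
    rw [← Finset.sum_fiberwise_of_maps_to (s := I) (t := univ.image lv) (g := lv)
      (fun i _ ↦ mem_image_of_mem _ (mem_univ i))]
    refine Finset.sum_eq_zero fun L _ ↦ ?_
    by_cases hex : (I.filter fun i ↦ lv i = L).Nonempty
    swap
    · rw [Finset.not_nonempty_iff_eq_empty.mp hex, Finset.sum_empty]
    obtain ⟨i₀, hi₀⟩ := hex
    rw [mem_filter, hI, mem_filter] at hi₀
    obtain ⟨⟨-, hMi₀, hnei₀⟩, hLi₀⟩ := hi₀
    have hML : M ∣ L := hLi₀ ▸ hMi₀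
    have hLM : L ≠ M := hLi₀ ▸ hnei₀
    haveI : NeZero L := ⟨hLi₀ ▸ hlv i₀⟩
    set g : ZMod L → ℂ := fun u ↦ (χ (ZMod.castHom hML (ZMod M) u))⁻¹ with hg
    have hg_odd : ∀ u, g (-u) = -g u := by
      intro u
      simp only [hg, map_neg]
      rw [show χ (-(ZMod.castHom hML (ZMod M) u)) = χ (-1) * χ (ZMod.castHom hML (ZMod M) u) by
        rw [← map_mul, neg_one_mul], hχ, neg_one_mul, inv_neg]
    have hrew : ∀ i ∈ I.filter (fun i ↦ lv i = L),
        A (lv i) * (χ (ZMod.cast (w i) : ZMod M))⁻¹ = A L * g (rd L i) := by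
      intro i hi
      have hiL : lv i = L := (mem_filter.mp hi).2
      rw [hrd L hML i hiL, hiL]
    rw [Finset.sum_congr rfl hrew, ← Finset.mul_sum]
    have hsum : ∑ i ∈ I.filter (fun i ↦ lv i = L), g (rd L i) = 0 := by
      refine sum_eq_zero_of_even_of_odd _ (rd L) g hg_odd fun u ↦ ?_
      have hfil : ∀ v : ZMod L, (I.filter (fun i ↦ lv i = L)).filter (fun i ↦ rd L i = v) =
          univ.filter fun i ↦ lv i = L ∧ rd L i = v := by
        intro v; ext i
        simp only [hI, Finset.filter_filter, mem_filter, mem_univ, true_and]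
        constructor
        · rintro ⟨⟨-, h2⟩, h3⟩; exact ⟨h2, h3⟩
        · rintro ⟨h2, h3⟩; exact ⟨⟨⟨h2 ▸ hML, h2 ▸ hLM⟩, h2⟩, h3⟩
      rw [hfil, hfil]
      exact heven L ⟨i₀, hLi₀⟩ hML hLM u
    rw [hsum, mul_zero]
  rw [hzero, add_zero, ← Finset.sum_filter, ← Finset.mul_sum] at key
  exact (mul_eq_zero.mp key).resolve_left hA

end Counting

end PairedNull

end Summit.HodgeConjecture.HodgeConjecture.Theorems.CancelByAnyClaimLattice

end
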